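import Summits.Ventures.HodgeRepro2.T5SU11JacobiPhaseLawRate
import Summits.Ventures.HodgeRepro2.T5SU11SphericalMonotone

/-!
# The rates OUTSIDE `0 ≤ λ ≤ 2`: `1 ≤ Φ_λ(s) ≤ e^{c' s}` with `c' = λ(λ − 2)/2`, and `|P_{k,λ}(k log|a| > x) − e^{−x}| ≤ (4c' + 2(2 + c')x) e^{−x/2}/k`

For `λ ≥ 2` the spherical function is `≥ 1` and increasing in the Cartan parameter
(`T5SU11SphericalBounds`, `T5SU11SphericalMonotone`), so the integrated radial equation
`sinh 2t · u'(t) = λ(λ − 2) ∫_0^t sinh 2τ · u(τ) dτ` gives `u'(t) ≤ c' u(t) tanh t` (`deriv_sph_hyp_le_of_two_le`),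
i.e. `log u − c' log cosh t` is antitone on `[0, ∞)`, and in the phase `s = log cosh t`:

  **`1 ≤ Φ_λ(s) ≤ e^{c' s}`**,  `c' = λ(λ − 2)/2`   (`sphPhase_le_exp_of_two_le`; by `Φ_λ = Φ_{2−λ}` also for `λ ≤ 0`,
  `sphPhase_le_exp_of_nonpos`).

Hence, with `r = k − 2 > c'`, the Laplace tails are pinned between two exponentials,
`e^{−ra}/r ≤ N(a) ≤ e^{−(r − c')a}/(r − c')` (`le_tail_of_two_le`, `tail_le_of_two_le`), the tail probability
satisfies `((r − c')/r) e^{−ra} ≤ N(a)/N(0) ≤ (r/(r − c')) e^{−(r − c')a}` (`tail_prob_ge_of_two_le`,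
`tail_prob_le_of_two_le`), and at `a = x/k`:

  **`|P_{k,λ}(k log|a| > x) − e^{−x}| ≤ (4c' + 2(2 + c') x) e^{−x/2}/k`**   for `k ≥ 4 + 2c'`, `λ ≥ 2` or `λ ≤ 0`
  (`abs_tail_prob_sub_exp_le_of_two_le`, `abs_tail_prob_sub_exp_le_of_nonpos`, on the group
  `abs_phase_tail_prob_sub_exp_le_of_two_le`)

— together with `T5SU11JacobiPhaseLawRateScaled` (`0 ≤ λ ≤ 2`) the convergence in law of the rescaled phase to
`Exp(1)` is of order `1/k` for EVERY real spectral parameter, with a constant depending on `λ` only through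
`c' = |λ(λ − 2)|/2`. Nothing is claimed about (N).

Blind lane: Mathlib + the HodgeRepro2 prefix only; no sorry; axioms ⊆ {propext, Classical.choice,
Quot.sound}.
-/

namespace Summit.Ventures.HodgeRepro2.T5SU11JacobiPhaseLawRateOutside

open MeasureTheory MeasureTheory.Measure Metric Set Filter Topology
open T5SU11Unimodular T5SU11Fibration T5SU11Cartan T5SU11OneParameter T5SU11CartanProjection T5HaarCircle
  T5BergmanCoefficient T5SU11FibrationHaar T5SU11SphericalFunction T5SU11SphericalSymmetry
  T5SU11SphericalBounds T5SU11SphericalContinuous T5SU11SphericalDeriv T5SU11SphericalLipschitz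
  T5SU11SphericalMonotone T5SU11SphericalTwo T5SU11JacobiLaplacePhase T5SU11JacobiPhaseTailGroup T5SU11JacobiPhaseLipschitz
  T5SU11JacobiPhaseLawRate
open scoped Real

section measure

variable [MeasurableSpace Circle] [BorelSpace Circle]

/-! ### The multiplicative bound `Φ_λ(s) ≤ e^{c' s}` for `λ ≥ 2` -/

/-- `u(τ) ≤ u(t)` for `0 ≤ τ ≤ t` and `λ ≥ 2`. -/
theorem sph_hyp_le_sph_hyp_of_two_le {lam : ℝ} (h2 : 2 ≤ lam) {τ t : ℝ} (hτ : 0 ≤ τ) (hτt : τ ≤ t) :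
    sph lam (hyp τ) ≤ sph lam (hyp t) := by
  rcases eq_or_lt_of_le h2 with rfl | hlt
  · rw [sph_two, sph_two]
  · exact (strictMonoOn_sph_hyp (Or.inr hlt)).monotoneOn (mem_Ici.mpr hτ) (mem_Ici.mpr (hτ.trans hτt)) hτt

/-- **The integral of the radial equation from above**: for `λ ≥ 2`, `t ≥ 0`,
`∫_0^t sinh 2τ · u(τ) dτ ≤ u(t) (cosh 2t − 1)/2`. -/
theorem integral_sinh_mul_sph_hyp_le {lam : ℝ} (h2 : 2 ≤ lam) {t : ℝ} (ht : 0 ≤ t) :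
    ∫ s in (0 : ℝ)..t, Real.sinh (2 * s) * sph lam (hyp s) ≤ sph lam (hyp t) * ((Real.cosh (2 * t) - 1) / 2) := by
  have hI : ∫ s in (0 : ℝ)..t, Real.sinh (2 * s) * sph lam (hyp t)
      = sph lam (hyp t) * ((Real.cosh (2 * t) - 1) / 2) := by
    rw [intervalIntegral.integral_mul_const, integral_sinh_two_mul, mul_comm]
  rw [← hI]
  refine intervalIntegral.integral_mono_on ht ((continuous_sinh_mul_sph_hyp lam).intervalIntegrable _ _)
    ((by fun_prop : Continuous fun s : ℝ => Real.sinh (2 * s) * sph lam (hyp t)).intervalIntegrable _ _)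
    fun s hs => ?_
  have hsh : 0 ≤ Real.sinh (2 * s) := Real.sinh_nonneg_iff.mpr (by linarith [hs.1])
  exact mul_le_mul_of_nonneg_left (sph_hyp_le_sph_hyp_of_two_le h2 hs.1 hs.2) hsh

/-- **`u'(t) ≤ c' u(t) tanh t`** for `λ ≥ 2`, `t > 0`, `c' = λ(λ − 2)/2`. -/
theorem deriv_sph_hyp_le_of_two_le {lam : ℝ} (h2 : 2 ≤ lam) {t : ℝ} (ht : 0 < t) :
    deriv (fun t => sph lam (hyp t)) t ≤ lam * (lam - 2) / 2 * sph lam (hyp t) * Real.tanh t := by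
  have hs : 0 < Real.sinh (2 * t) := Real.sinh_pos_iff.mpr (by linarith)
  have h := sinh_mul_deriv_eq_integral lam t
  have hI := integral_sinh_mul_sph_hyp_le h2 ht.le
  have hl : 0 ≤ lam * (lam - 2) := mul_nonneg (by linarith) (by linarith)
  have h1 : Real.sinh (2 * t) * deriv (fun t => sph lam (hyp t)) t
      ≤ lam * (lam - 2) * (sph lam (hyp t) * ((Real.cosh (2 * t) - 1) / 2)) := by
    rw [h]
    exact mul_le_mul_of_nonneg_left hI hl
  rw [cosh_two_mul_sub_one] at h1
  have h2' : Real.sinh (2 * t) * deriv (fun t => sph lam (hyp t)) t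
      ≤ Real.sinh (2 * t) * (lam * (lam - 2) / 2 * sph lam (hyp t) * Real.tanh t) := by
    refine h1.trans (le_of_eq ?_)
    ring
  exact le_of_mul_le_mul_left h2' hs

/-- **`log u − c' log cosh t` is antitone on `[0, ∞)`** for `λ ≥ 2`. -/
theorem antitoneOn_log_sph_hyp_sub {lam : ℝ} (h2 : 2 ≤ lam) :
    AntitoneOn (fun t : ℝ => Real.log (sph lam (hyp t)) - lam * (lam - 2) / 2 * Real.log (Real.cosh t))
      (Ici 0) := by
  have hdiff : Differentiable ℝ fun t : ℝ => Real.log (sph lam (hyp t))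
      - lam * (lam - 2) / 2 * Real.log (Real.cosh t) :=
    ((differentiable_sph_hyp lam).log fun t => (sph_hyp_pos lam t).ne').sub
      (differentiable_log_cosh.const_mul _)
  refine antitoneOn_of_deriv_nonpos (convex_Ici 0) hdiff.continuous.continuousOn hdiff.differentiableOn ?_
  intro x hx
  rw [interior_Ici] at hx
  have hd : HasDerivAt (fun t : ℝ => Real.log (sph lam (hyp t)) - lam * (lam - 2) / 2 * Real.log (Real.cosh t))
      (deriv (fun t => sph lam (hyp t)) x / sph lam (hyp x) - lam * (lam - 2) / 2 * Real.tanh x) x :=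
    ((differentiable_sph_hyp lam x).hasDerivAt.log (sph_hyp_pos lam x).ne').sub
      ((hasDerivAt_log_cosh x).const_mul _)
  rw [hd.deriv]
  have hu := deriv_sph_hyp_le_of_two_le h2 hx
  have hpos := sph_hyp_pos lam x
  rw [sub_nonpos, div_le_iff₀ hpos]
  linarith

/-- **`Φ_λ(s) ≤ e^{c' s}`** for `λ ≥ 2`, `s ≥ 0`, `c' = λ(λ − 2)/2`. -/
theorem sphPhase_le_exp_of_two_le {lam : ℝ} (h2 : 2 ≤ lam) {s : ℝ} (hs : 0 ≤ s) :
    sphPhase lam s ≤ Real.exp (lam * (lam - 2) / 2 * s) := by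
  have h := antitoneOn_log_sph_hyp_sub h2 (mem_Ici.mpr (le_refl (0 : ℝ)))
    (mem_Ici.mpr (cartanOfPhase_nonneg' s)) (cartanOfPhase_nonneg' s)
  simp only [T5SU11OneParameter.hyp_zero, sph_one, Real.log_one, Real.cosh_zero, sub_zero, mul_zero,
    log_cosh_cartanOfPhase hs] at h
  unfold sphPhase
  have hpos := sph_hyp_pos lam (cartanOfPhase s)
  rw [← Real.log_le_log_iff hpos (Real.exp_pos _), Real.log_exp]
  linarith

/-- **`1 ≤ Φ_λ(s)`** for `λ ≥ 2`. -/
theorem one_le_sphPhase_of_two_le {lam : ℝ} (h2 : 2 ≤ lam) (s : ℝ) : 1 ≤ sphPhase lam s :=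
  one_le_sph_hyp_of_two_le h2 _

/-- **`Φ_λ(s) ≤ e^{c' s}`** for `λ ≤ 0` (by `Φ_λ = Φ_{2−λ}` and `(2 − λ)(−λ) = λ(λ − 2)`). -/
theorem sphPhase_le_exp_of_nonpos {lam : ℝ} (h0 : lam ≤ 0) {s : ℝ} (hs : 0 ≤ s) :
    sphPhase lam s ≤ Real.exp (lam * (lam - 2) / 2 * s) := by
  rw [sphPhase_two_sub]
  have := sphPhase_le_exp_of_two_le (lam := 2 - lam) (by linarith) hs
  rwa [show (2 - lam) * (2 - lam - 2) / 2 = lam * (lam - 2) / 2 by ring] at this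

/-! ### The Laplace tails pinned between two exponentials -/

/-- **The tail from below**: for `λ ≥ 2`, `k > λ` (the ray), `a ≥ 0`, `e^{−(k−2)a}/(k − 2) ≤ N(a)`. -/
theorem le_tail_of_two_le {k lam a : ℝ} (h2 : 2 ≤ lam) (hk : lam < k) (ha : 0 ≤ a) :
    Real.exp (-((k - 2) * a)) / (k - 2) ≤ ∫ s in Ioi a, Real.exp (-((k - 2) * s)) * sphPhase lam s := by
  have hr : 0 < k - 2 := by linarith
  have hint1 : IntegrableOn (fun s : ℝ => Real.exp (-((k - 2) * s))) (Ioi a) := by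
    refine (integrableOn_exp_mul_Ioi (by linarith : -(k - 2) < 0) a).congr_fun (fun s _ => ?_)
      measurableSet_Ioi
    simp only
    ring_nf
  rw [← integral_exp_neg_mul_Ioi_eq hr a]
  refine setIntegral_mono_on hint1
    ((integrableOn_exp_mul_sphPhase (by linarith) hk (by linarith)).mono_set (Ioi_subset_Ioi ha))
    measurableSet_Ioi fun s _ => ?_
  exact le_mul_of_one_le_right (Real.exp_pos _).le (one_le_sphPhase_of_two_le h2 s)

/-- **The tail from above**: for `λ ≥ 2`, `k − 2 > c'`, `a ≥ 0`, `N(a) ≤ e^{−(k−2−c')a}/(k − 2 − c')`. -/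
theorem tail_le_of_two_le {k lam a : ℝ} (h2 : 2 ≤ lam) (hk : lam * (lam - 2) / 2 < k - 2) (ha : 0 ≤ a) :
    ∫ s in Ioi a, Real.exp (-((k - 2) * s)) * sphPhase lam s
      ≤ Real.exp (-((k - 2 - lam * (lam - 2) / 2) * a)) / (k - 2 - lam * (lam - 2) / 2) := by
  set c : ℝ := lam * (lam - 2) / 2 with hc
  have hc0 : 0 ≤ c := by rw [hc]; exact div_nonneg (mul_nonneg (by linarith) (by linarith)) (by norm_num)
  have hr : 0 < k - 2 - c := by linarith
  have hk' : lam < k := by nlinarith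
  have hint2 : IntegrableOn (fun s : ℝ => Real.exp (-((k - 2 - c) * s))) (Ioi a) := by
    refine (integrableOn_exp_mul_Ioi (by linarith : -(k - 2 - c) < 0) a).congr_fun (fun s _ => ?_)
      measurableSet_Ioi
    simp only
    ring_nf
  rw [← integral_exp_neg_mul_Ioi_eq hr a]
  refine setIntegral_mono_on
    ((integrableOn_exp_mul_sphPhase (by linarith) hk' (by linarith)).mono_set (Ioi_subset_Ioi ha)) hint2
    measurableSet_Ioi fun s hs => ?_
  have hs0 : 0 ≤ s := le_of_lt (lt_of_le_of_lt ha hs)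
  calc Real.exp (-((k - 2) * s)) * sphPhase lam s
      ≤ Real.exp (-((k - 2) * s)) * Real.exp (c * s) :=
        mul_le_mul_of_nonneg_left (sphPhase_le_exp_of_two_le h2 hs0) (Real.exp_pos _).le
    _ = Real.exp (-((k - 2 - c) * s)) := by
        rw [← Real.exp_add]
        congr 1
        ring

/-- **The tail probability from above**: for `λ ≥ 2`, `k − 2 > c'`, `a ≥ 0`,
`N(a)/N(0) ≤ ((k − 2)/(k − 2 − c')) e^{−(k−2−c')a}`. -/
theorem tail_prob_le_of_two_le {k lam a : ℝ} (h2 : 2 ≤ lam) (hk : lam * (lam - 2) / 2 < k - 2) (ha : 0 ≤ a) :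
    (∫ s in Ioi a, Real.exp (-((k - 2) * s)) * sphPhase lam s)
        / ∫ s in Ioi (0 : ℝ), Real.exp (-((k - 2) * s)) * sphPhase lam s
      ≤ (k - 2) / (k - 2 - lam * (lam - 2) / 2) * Real.exp (-((k - 2 - lam * (lam - 2) / 2) * a)) := by
  set c : ℝ := lam * (lam - 2) / 2 with hc
  have hc0 : 0 ≤ c := by rw [hc]; exact div_nonneg (mul_nonneg (by linarith) (by linarith)) (by norm_num)
  have hr : 0 < k - 2 := by linarith
  have hrc : 0 < k - 2 - c := by linarith
  have hk' : lam < k := by nlinarith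
  have hN0 := le_tail_of_two_le h2 hk' (le_refl (0 : ℝ))
  simp only [mul_zero, neg_zero, Real.exp_zero] at hN0
  have hNa := tail_le_of_two_le h2 hk ha
  rw [← hc] at hNa
  have hN0pos : 0 < ∫ s in Ioi (0 : ℝ), Real.exp (-((k - 2) * s)) * sphPhase lam s :=
    lt_of_lt_of_le (by positivity) hN0
  rw [div_le_iff₀ hN0pos]
  calc ∫ s in Ioi a, Real.exp (-((k - 2) * s)) * sphPhase lam s
      ≤ Real.exp (-((k - 2 - c) * a)) / (k - 2 - c) := hNa
    _ = (k - 2) / (k - 2 - c) * Real.exp (-((k - 2 - c) * a)) * (1 / (k - 2)) := by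
        field_simp
    _ ≤ (k - 2) / (k - 2 - c) * Real.exp (-((k - 2 - c) * a))
          * ∫ s in Ioi (0 : ℝ), Real.exp (-((k - 2) * s)) * sphPhase lam s :=
        mul_le_mul_of_nonneg_left hN0 (by positivity)

/-- **The tail probability from below**: for `λ ≥ 2`, `k − 2 > c'`, `a ≥ 0`,
`((k − 2 − c')/(k − 2)) e^{−(k−2)a} ≤ N(a)/N(0)`. -/
theorem tail_prob_ge_of_two_le {k lam a : ℝ} (h2 : 2 ≤ lam) (hk : lam * (lam - 2) / 2 < k - 2) (ha : 0 ≤ a) :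
    (k - 2 - lam * (lam - 2) / 2) / (k - 2) * Real.exp (-((k - 2) * a))
      ≤ (∫ s in Ioi a, Real.exp (-((k - 2) * s)) * sphPhase lam s)
        / ∫ s in Ioi (0 : ℝ), Real.exp (-((k - 2) * s)) * sphPhase lam s := by
  set c : ℝ := lam * (lam - 2) / 2 with hc
  have hc0 : 0 ≤ c := by rw [hc]; exact div_nonneg (mul_nonneg (by linarith) (by linarith)) (by norm_num)
  have hr : 0 < k - 2 := by linarith
  have hrc : 0 < k - 2 - c := by linarith
  have hk' : lam < k := by nlinarith
  have hN0 := tail_le_of_two_le h2 hk (le_refl (0 : ℝ))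
  simp only [mul_zero, neg_zero, Real.exp_zero] at hN0
  rw [← hc] at hN0
  have hNa := le_tail_of_two_le h2 hk' ha
  have hN0pos : 0 < ∫ s in Ioi (0 : ℝ), Real.exp (-((k - 2) * s)) * sphPhase lam s := by
    have := le_tail_of_two_le h2 hk' (le_refl (0 : ℝ))
    simp only [mul_zero, neg_zero, Real.exp_zero] at this
    exact lt_of_lt_of_le (by positivity) this
  rw [le_div_iff₀ hN0pos]
  calc (k - 2 - c) / (k - 2) * Real.exp (-((k - 2) * a))
        * ∫ s in Ioi (0 : ℝ), Real.exp (-((k - 2) * s)) * sphPhase lam s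
      ≤ (k - 2 - c) / (k - 2) * Real.exp (-((k - 2) * a)) * (1 / (k - 2 - c)) :=
        mul_le_mul_of_nonneg_left hN0 (by positivity)
    _ = Real.exp (-((k - 2) * a)) / (k - 2) := by
        field_simp
    _ ≤ _ := hNa

/-! ### The rate `O(1/k)` -/

/-- **THE RATE OF THE LIMIT LAW FOR `λ ≥ 2`**: for `k ≥ 4 + 2c'`, `x ≥ 0`, `c' = λ(λ − 2)/2`,
`|N(x/k)/N(0) − e^{−x}| ≤ (4c' + 2(2 + c') x) e^{−x/2}/k`. -/
theorem abs_tail_prob_sub_exp_le_of_two_le {k lam x : ℝ} (h2 : 2 ≤ lam) (hk : 4 + 2 * (lam * (lam - 2) / 2) ≤ k)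
    (hx : 0 ≤ x) :
    |(∫ s in Ioi (x / k), Real.exp (-((k - 2) * s)) * sphPhase lam s)
        / (∫ s in Ioi (0 : ℝ), Real.exp (-((k - 2) * s)) * sphPhase lam s) - Real.exp (-x)|
      ≤ (4 * (lam * (lam - 2) / 2) + 2 * (2 + lam * (lam - 2) / 2) * x) * Real.exp (-(x / 2)) / k := by
  set c : ℝ := lam * (lam - 2) / 2 with hc
  have hc0 : 0 ≤ c := by rw [hc]; exact div_nonneg (mul_nonneg (by linarith) (by linarith)) (by norm_num)
  have hk4 : 4 ≤ k := by linarith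
  have hk0 : 0 < k := by linarith
  have hr : 0 < k - 2 := by linarith
  have hrc : c < k - 2 := by linarith
  have hrc' : 0 < k - 2 - c := by linarith
  have ha : 0 ≤ x / k := div_nonneg hx hk0.le
  have hup := tail_prob_le_of_two_le h2 hrc ha
  have hlo := tail_prob_ge_of_two_le h2 hrc ha
  rw [← hc] at hup hlo
  set T : ℝ := (∫ s in Ioi (x / k), Real.exp (-((k - 2) * s)) * sphPhase lam s)
    / (∫ s in Ioi (0 : ℝ), Real.exp (-((k - 2) * s)) * sphPhase lam s) with hT
  clear_value T
  set A : ℝ := Real.exp (-x) with hA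
  have hApos : 0 < A := Real.exp_pos _
  set D : ℝ := Real.exp (-(x / 2)) with hD
  have hDpos : 0 < D := Real.exp_pos _
  -- the two exponentials at `a = x/k`
  have e1 : Real.exp (-((k - 2 - c) * (x / k))) = A * Real.exp ((2 + c) * x / k) := by
    rw [hA, ← Real.exp_add]
    congr 1
    field_simp
    ring
  have e2 : Real.exp (-((k - 2) * (x / k))) = A * Real.exp (2 * x / k) := by
    rw [hA, ← Real.exp_add]
    congr 1
    field_simp
    ring
  rw [e1] at hup
  rw [e2] at hlo
  set E : ℝ := Real.exp ((2 + c) * x / k) with hE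
  set E₂ : ℝ := Real.exp (2 * x / k) with hE₂
  have hE1 : 1 ≤ E := Real.one_le_exp (by positivity)
  have hE21 : 1 ≤ E₂ := Real.one_le_exp (by positivity)
  -- `e^{(2+c)x/k} ≤ e^{x/2}` since `(2 + c)/k ≤ 1/2`; `e^{2x/k} ≤ e^{x/2}` since `k ≥ 4`
  have hEle : A * E ≤ D := by
    rw [hA, hE, hD, ← Real.exp_add, Real.exp_le_exp]
    have : (2 + c) * x / k ≤ x / 2 := by
      rw [div_le_div_iff₀ hk0 two_pos]
      nlinarith
    linarith
  have hE2le : A * E₂ ≤ D := by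
    rw [hA, hE₂, hD, ← Real.exp_add, Real.exp_le_exp]
    have : 2 * x / k ≤ x / 2 := by
      rw [div_le_div_iff₀ hk0 two_pos]
      nlinarith
    linarith
  have hAle : A ≤ D := by
    rw [hA, hD, Real.exp_le_exp]
    linarith
  have hEsub : E - 1 ≤ (2 + c) * x / k * E := exp_sub_one_le_mul_exp _
  clear_value A D E E₂
  -- the ratio `(k − 2)/(k − 2 − c) ≤ 1 + 2c/k`  (`2c ≤ k − 2`)
  have hratio : (k - 2) / (k - 2 - c) ≤ 1 + 2 * c / k := by
    rw [div_le_iff₀ hrc']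
    have hck : 2 * c ≤ k - 2 := by linarith
    have h3 : c ≤ 2 * c * (k - 2 - c) / k := by
      rw [le_div_iff₀ hk0]
      nlinarith
    have e : (1 + 2 * c / k) * (k - 2 - c) = (k - 2 - c) + 2 * c * (k - 2 - c) / k := by ring
    rw [e]
    linarith
  have hck1 : 2 * c / k ≤ 1 := by
    rw [div_le_one hk0]
    linarith
  -- upper: `T − A ≤ A E (1 + 2c/k) − A ≤ A [2(E − 1) + 2c/k] ≤ (2(2+c)x (AE) + 2c A)/k`
  have hU : T - A ≤ (4 * c + 2 * (2 + c) * x) * D / k := by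
    have h1 : T ≤ A * E * (1 + 2 * c / k) := by
      refine hup.trans ?_
      rw [show (k - 2) / (k - 2 - c) * (A * E) = A * E * ((k - 2) / (k - 2 - c)) by ring]
      exact mul_le_mul_of_nonneg_left hratio (by positivity)
    have hE0 : 0 ≤ E - 1 := by linarith
    have h3 : (E - 1) * (1 + 2 * c / k) ≤ 2 * (E - 1) := by nlinarith
    have h4 : A * E * (1 + 2 * c / k) - A = A * ((E - 1) * (1 + 2 * c / k) + 2 * c / k) := by ring
    have h5 : A * ((E - 1) * (1 + 2 * c / k) + 2 * c / k) ≤ A * (2 * ((2 + c) * x / k * E) + 2 * c / k) := by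
      apply mul_le_mul_of_nonneg_left _ hApos.le
      linarith
    have h6 : A * (2 * ((2 + c) * x / k * E) + 2 * c / k) = (2 * (2 + c) * x * (A * E) + 2 * c * A) / k := by
      field_simp
    have h7 : 2 * (2 + c) * x * (A * E) + 2 * c * A ≤ (4 * c + 2 * (2 + c) * x) * D := by
      have hx' : 0 ≤ 2 * (2 + c) * x := by positivity
      have hh1 : 2 * (2 + c) * x * (A * E) ≤ 2 * (2 + c) * x * D := mul_le_mul_of_nonneg_left hEle hx'
      have hh2 : 2 * c * A ≤ 2 * c * D := mul_le_mul_of_nonneg_left hAle (by positivity)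
      have hh3 : 0 ≤ c * D := mul_nonneg hc0 hDpos.le
      linarith
    calc T - A ≤ A * E * (1 + 2 * c / k) - A := by linarith
      _ = A * ((E - 1) * (1 + 2 * c / k) + 2 * c / k) := h4
      _ ≤ A * (2 * ((2 + c) * x / k * E) + 2 * c / k) := h5
      _ = (2 * (2 + c) * x * (A * E) + 2 * c * A) / k := h6
      _ ≤ (4 * c + 2 * (2 + c) * x) * D / k := div_le_div_of_nonneg_right h7 hk0.le
  -- lower: `A − T ≤ A − (1 − c/(k−2)) A E₂ = A(1 − E₂) + (c/(k−2)) A E₂ ≤ (c/(k−2)) D ≤ 2c D/k`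
  have hL : A - T ≤ (4 * c + 2 * (2 + c) * x) * D / k := by
    have h1 : (1 - c / (k - 2)) * (A * E₂) ≤ T := by
      refine le_trans (le_of_eq ?_) hlo
      field_simp
    have hck' : c / (k - 2) ≤ 2 * c / k := by
      rw [div_le_div_iff₀ hr hk0]
      nlinarith
    have hcr0 : 0 ≤ c / (k - 2) := div_nonneg hc0 hr.le
    have h2' : A - (1 - c / (k - 2)) * (A * E₂) ≤ c / (k - 2) * D := by
      have e : A - (1 - c / (k - 2)) * (A * E₂) = A * (1 - E₂) + c / (k - 2) * (A * E₂) := by ring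
      rw [e]
      have h1' : A * (1 - E₂) ≤ 0 := mul_nonpos_of_nonneg_of_nonpos hApos.le (by linarith)
      have h2'' : c / (k - 2) * (A * E₂) ≤ c / (k - 2) * D := mul_le_mul_of_nonneg_left hE2le hcr0
      linarith
    have h3 : c / (k - 2) * D ≤ 2 * c / k * D := mul_le_mul_of_nonneg_right hck' hDpos.le
    have h4 : 2 * c / k * D ≤ (4 * c + 2 * (2 + c) * x) * D / k := by
      rw [show 2 * c / k * D = 2 * c * D / k by ring]
      apply div_le_div_of_nonneg_right _ hk0.le
      have hx' : 0 ≤ 2 * (2 + c) * x := by positivity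
      have hh1 : 0 ≤ c * D := mul_nonneg hc0 hDpos.le
      have hh2 : 0 ≤ 2 * (2 + c) * x * D := mul_nonneg hx' hDpos.le
      linarith
    linarith
  rw [abs_le]
  constructor <;> linarith

/-- **THE RATE FOR `λ ≤ 0`** (by `Φ_λ = Φ_{2−λ}`): for `k ≥ 4 + 2c'`, `x ≥ 0`, `c' = λ(λ − 2)/2`,
`|N(x/k)/N(0) − e^{−x}| ≤ (4c' + 2(2 + c') x) e^{−x/2}/k`. -/
theorem abs_tail_prob_sub_exp_le_of_nonpos {k lam x : ℝ} (h0 : lam ≤ 0) (hk : 4 + 2 * (lam * (lam - 2) / 2) ≤ k)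
    (hx : 0 ≤ x) :
    |(∫ s in Ioi (x / k), Real.exp (-((k - 2) * s)) * sphPhase lam s)
        / (∫ s in Ioi (0 : ℝ), Real.exp (-((k - 2) * s)) * sphPhase lam s) - Real.exp (-x)|
      ≤ (4 * (lam * (lam - 2) / 2) + 2 * (2 + lam * (lam - 2) / 2) * x) * Real.exp (-(x / 2)) / k := by
  have e : (2 - lam) * (2 - lam - 2) / 2 = lam * (lam - 2) / 2 := by ring
  have h := abs_tail_prob_sub_exp_le_of_two_le (lam := 2 - lam) (k := k) (x := x) (by linarith)
    (by rw [e]; exact hk) hx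
  rw [e] at h
  simp_rw [← sphPhase_two_sub lam] at h
  exact h

/-- **ON THE GROUP, `λ ≥ 2`**: for `k ≥ 4 + 2c'`, `x ≥ 0`,
`|P_{k,λ}(k log|a| > x) − e^{−x}| ≤ (4c' + 2(2 + c') x) e^{−x/2}/k`. -/
theorem abs_phase_tail_prob_sub_exp_le_of_two_le {k lam x : ℝ} (h2 : 2 ≤ lam)
    (hk : 4 + 2 * (lam * (lam - 2) / 2) ≤ k) (hx : 0 ≤ x) :
    |(∫ g in {g : SU11 | x / k < Real.log ‖mat g 0 0‖},
          (1 - ‖orbit g‖ ^ 2) ^ (k / 2) * sph lam g ∂(nu haarCircle))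
        / (∫ g, (1 - ‖orbit g‖ ^ 2) ^ (k / 2) * sph lam g ∂(nu haarCircle)) - Real.exp (-x)|
      ≤ (4 * (lam * (lam - 2) / 2) + 2 * (2 + lam * (lam - 2) / 2) * x) * Real.exp (-(x / 2)) / k := by
  have hc0 : 0 ≤ lam * (lam - 2) / 2 := div_nonneg (mul_nonneg (by linarith) (by linarith)) (by norm_num)
  have hk0 : 0 < k := by linarith
  have hk' : lam < k := by nlinarith
  rw [integral_phase_tail_eq (by linarith) hk' (by linarith) (div_nonneg hx hk0.le),
    jacobi_eq_laplace_phase (by linarith) hk' (by linarith),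
    mul_div_mul_left _ _ (by positivity : (2 * π : ℝ) ≠ 0)]
  exact abs_tail_prob_sub_exp_le_of_two_le h2 hk hx

end measure

end Summit.Ventures.HodgeRepro2.T5SU11JacobiPhaseLawRateOutside
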